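import Summits.ResolutionOfSingularities.ResolutionOfSingularities.Theorems.FrobeniusClosingSteerSwitchingAssemblySeq
import Summits.ResolutionOfSingularities.ResolutionOfSingularities.Theorems.FrobeniusClosingSteerCore4CompositeRankConcl
import Mathlib.RingTheory.Valuation.RankOne
import HarnessLib

/-!
# Crux `Steer` (stmt-ResolutionOfSingularities-16345), line `switching_dichotomy` r15: the ARCHIMEDEAN BRIDGE
# `NotCoarseningArchSeq` — no proper coarsening ⇒ the quadratic sequence is parameter-archimedean

OURS (campaign `res-hironaka`, rung L ★L-G4, slot W4.1, chain W4.1; seat res-D-pv-007 AS res-L0-w41-stub-5, row (S) of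
res-L0-w41-plan-1's SEAT TABLE v5.4 §C; replaces the role of no printed item; NOT a statement of the manuscript under
review [claim: Hironaka2017, status: under-review]; AI review is weaker than expert review). This Theses-free helper proves
the planner's piece **(S) `NotCoarseningArchSeq`** (`L/res-L0-w41-plan-1/Sketch-R2-recut.lean` §5, ≡ res-L0-w41-idea-2's
`NotArchCoarsening` read contrapositively) with the line's vocabulary (`ArchSeq`, `IsFracOf`) UNFOLDED verbatim, so that
the holder's in-skeleton use is a definitional `exact`:

for a valuation ring `O ≠ K` of `K` WITHOUT PROPER COARSENING (no valuation ring strictly between `O` and `K`: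
`¬ SteerRankThinness.HasProperCoarsening O`, i.e. rank one) and any finitely generated base `A₀ ⊆ O` regular at the
centre, the quadratic sequence of the base along `O` is PARAMETER-ARCHIMEDEAN (`ArchSeq O A₀`): every non-zero fraction
`y` of `A₀` in `𝔪_O` is archimedeanly dominated by a regular parameter of some member of the sequence.

Route (the planner's): `SteerRankThinness.rankOne_of_not_hasProperCoarsening` (tree, p493665) ⇒ `O.valuation` has rank
one ⇒ its value group embeds strictly monotonically into `ℝ≥0` (Mathlib `Valuation.RankOne`), so `v x < 1`, `y ≠ 0`
give `v x ^ n < v y` for some `n` (`exists_pow_valuation_lt_of_rankOne`, archimedean property of `ℝ≥0`) ⇒ the LANDED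
`SwitchingDichotomy.archSeq_of_arch` (`Theorems/FrobeniusClosingSteerSwitchingAssemblySeq.lean`).
[cite: HeinzerEtAl2015, Remark 2.4] [folklore]
-/

noncomputable section

-- `Summit.<S>.<S>.…` duplicates the summit name by design (single-problem summit).
set_option linter.dupNamespace false

open IsLocalRing

namespace Summit.ResolutionOfSingularities.ResolutionOfSingularities.Theorems.SwitchingDichotomy

open Literature.AlgebraicGeometry.Resolution
open Summit.ResolutionOfSingularities.ResolutionOfSingularities.Theorems.SteerRankThinness
  (HasProperCoarsening rankOne_of_not_hasProperCoarsening)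

/-- **Rank one is archimedean**: for a valuation ring `O` whose valuation has rank one (Mathlib `Valuation.RankOne`:
a strictly monotone embedding of the value group into `ℝ≥0`), every `x` with `v x < 1` has powers of value below
any non-zero value: `y ≠ 0 ⇒ ∃ n, v x ^ n < v y`. [cite: HeinzerEtAl2015, Remark 2.4 (rank one = archimedean value group)]
[folklore] -/
theorem exists_pow_valuation_lt_of_rankOne {K : Type} [Field K] (O : ValuationSubring K)
    (hr : Nonempty O.valuation.RankOne) {x y : K} (hx : O.valuation x < 1) (hy : y ≠ 0) :
    ∃ n : ℕ, O.valuation x ^ n < O.valuation y := by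
  obtain ⟨hr⟩ := hr
  have hx' : O.valuation.restrict x < 1 := (Valuation.restrict_lt_one_iff O.valuation).2 hx
  have h1 : Valuation.RankOne.hom O.valuation (O.valuation.restrict x) < 1 := by
    have := Valuation.RankOne.strictMono O.valuation hx'
    rwa [map_one] at this
  have hy' : O.valuation.restrict y ≠ 0 := (Valuation.ne_zero_iff _).2 hy
  have h0 : 0 < Valuation.RankOne.hom O.valuation (O.valuation.restrict y) :=
    pos_iff_ne_zero.2 fun h => hy' (Valuation.RankOne.zero_of_hom_zero _ h)
  obtain ⟨n, hn⟩ := exists_pow_lt_of_lt_one h0 h1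
  refine ⟨n, ?_⟩
  rw [← map_pow] at hn
  have hlt := (Valuation.RankOne.strictMono O.valuation).lt_iff_lt.1 hn
  rw [← map_pow, Valuation.restrict_lt_iff O.valuation, map_pow] at hlt
  exact hlt

/-- **(S) `NotCoarseningArchSeq`** (res-L0-w41-plan-1 Sketch-R2-recut §5, verbatim binder order; `ArchSeq O A₀` and
`IsFracOf A₀` of the line `switching_dichotomy` UNFOLDED): along a valuation ring `O ≠ K` WITHOUT proper coarsening the
quadratic sequence of every finitely generated base regular at the centre is parameter-archimedean — by rank one
(`rankOne_of_not_hasProperCoarsening`), the archimedean property (`exists_pow_valuation_lt_of_rankOne`) and the landed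
`archSeq_of_arch`. Consequence recorded by the planner (CHAIN v5.4 §B2): at `n = 4`, modulo `Sig.stub_cp2019General`,
every frontier stub reads its core datum as rank one WITH `ArchSeq`. [cite: HeinzerEtAl2015, Remark 2.4] [folklore] -/
theorem notCoarseningArchSeq :
    ∀ (k K : Type) [Field k] [Field K] [Algebra k K] (O : ValuationSubring K) (A₀ : Subalgebra k K)
      (h₀ : A₀.toSubring ≤ O.toSubring), O ≠ ⊤ → ¬ HasProperCoarsening O →
      IsRegularLocalRing (Localization.AtPrime
        (Ideal.comap (Subring.inclusion h₀) (IsLocalRing.maximalIdeal O))) →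
      ∀ R : ℕ → Subring K, R 0 = locAtCentre A₀.toSubring O →
        (∀ i, IsQuadraticTransformAlong O (R i) (R (i + 1))) →
        ∀ y : K, (∃ a ∈ A₀, ∃ b ∈ A₀, b ≠ 0 ∧ y = a / b) → y ≠ 0 → O.valuation y < 1 →
          ∃ (i : ℕ) (_ : IsLocalRing (R i)) (z : Fin 1 → R i), IsRsopPart z ∧
            ∃ n : ℕ, O.valuation ((z 0 : R i) : K) ^ n < O.valuation y := by
  intro k K _ _ _ O A₀ h₀ hO hnc hreg
  exact archSeq_of_arch O A₀ h₀ hreg fun x y _ _ hy hx =>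
    exists_pow_valuation_lt_of_rankOne O (rankOne_of_not_hasProperCoarsening O hO hnc) hx hy

end Summit.ResolutionOfSingularities.ResolutionOfSingularities.Theorems.SwitchingDichotomy

end
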